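import Mathlib
import Summits.Ventures.PercRepro2.MixChordOEdgeRead
import Summits.Ventures.PercRepro2.MixChordClasses

/-!
# Reading the open child of ANY `o`-class root edge on the closed child
(blind cell PercRepro2, night-1 g28; proofs/NIGHT1-G28.md §6 (a))

An `o`-class root edge `e = {x, y}` has `x` in the weight-`1` cluster of `a₁` and `o` in the weight-`1`
cluster of `y` (`OClass`, one of its two orientations); on the support of `p` every weight-`1` edge is open
(`oneConfig_le_update_false`), so `a₁ ↔ x` and `y ↔ o` surely at the closed child.  Hence the readings of
MixChordOEdgeRead.lean hold VERBATIM on the support: `Q` after opening `e` reads as `Qo = Q ∩ {a₂ ↮ o}`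
(`Q_update_true_iff_support`), `v ∈ C₁` as `readL v = {v ∈ C₁} ∪ {v ↔ o}` (`reads_conn1`), `v ∈ C₂` as itself
(`reads_conn2`), closed under `∩`, `∪`, `ᶜ`, and **`prob_read`** (g19's support coupling
`prob_update_one_eq_prob_update_zero_of_iff_support`): `P¹(Q ∩ S) = P⁰(Qo ∩ S′)`.  The twelve atoms of
MixChordBern.lean's `A`, `B` at `p[e ↦ 1]` are then `p[e ↦ 0]`-probabilities of the SAME explicit events as
along the literal `o`-edge (`Z_read` … `gap_read`; `gap` through `prob_conn1_read`, `prob_conn2_read`) — the row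
`DZChordO_all` is, along EVERY `o`-class root edge of every instance, the pair `A ≥ 0 ∧ B ≥ 0` read on the closed
child's refined cells.  The hypotheses are exactly `OClass`'s data in the `a₁`-orientation (`ends e = s(x, y)`,
`x ∈ cluster ends (oneConfig p) a₁`, `o ∈ cluster ends (oneConfig p) y`) plus `e ∈ Chord.frac p` (every root
edge is fractional, `Chord.frac_of_mem_rootEdges`); the `a₂`-orientation is the root swap.

Own code; standard axioms.
-/

namespace Summit.Ventures.PercRepro2

open UnionCluster CovForm

namespace Mix

namespace OClassRead

open OEdgeRead

section Reads

variable {V : Type*} {E : Type*} [Fintype E] [DecidableEq E] {R : Type*} [Field R] [LinearOrder R]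
  [IsStrictOrderedRing R]

variable (p : E → R) (ends : E → Sym2 V) (o a₁ a₂ : V) (e : E)

/-- A `p[e ↦ 1]`-event `S` READS AS the `p[e ↦ 0]`-event `S′` on the support of `p` and on `Qo`. -/
def ReadsAsS (S S' : Set (Config E)) : Prop :=
  ∀ ω : Config E, weight p ω ≠ 0 → Function.update ω e false ∈ Qo ends o a₁ a₂ →
    (Function.update ω e true ∈ S ↔ Function.update ω e false ∈ S')

variable {p ends o a₁ a₂ e} {x y : V}

/-- On the support, `a₁ ↔ x` at the closed child. -/
lemma conn_a1_x (hx : x ∈ cluster ends (Chord.oneConfig p) a₁) (hfr : e ∈ Chord.frac p) {ω : Config E}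
    (hω : weight p ω ≠ 0) : Conn ends (Function.update ω e false) a₁ x :=
  conn_mono (oneConfig_le_update_false hω hfr) (mem_cluster.1 hx)

/-- On the support, `y ↔ o` at the closed child. -/
lemma conn_y_o (hy : o ∈ cluster ends (Chord.oneConfig p) y) (hfr : e ∈ Chord.frac p) {ω : Config E}
    (hω : weight p ω ≠ 0) : Conn ends (Function.update ω e false) y o :=
  conn_mono (oneConfig_le_update_false hω hfr) (mem_cluster.1 hy)

/-- **`Q` after opening `e` reads as `Qo`** on the support. -/
lemma Q_update_true_iff_support (he : ends e = s(x, y)) (hx : x ∈ cluster ends (Chord.oneConfig p) a₁)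
    (hy : o ∈ cluster ends (Chord.oneConfig p) y) (hfr : e ∈ Chord.frac p) {ω : Config E}
    (hω : weight p ω ≠ 0) :
    Function.update ω e true ∈ avoidAll ends a₂ {a₁} ↔ Function.update ω e false ∈ Qo ends o a₁ a₂ := by
  have h1x := conn_a1_x hx hfr hω
  have hyo := conn_y_o hy hfr hω
  rw [mem_Qo_iff, update_true_eq ω]
  simp only [mem_avoidAll, Finset.mem_singleton, forall_eq, OneEdge.conn_update_true_iff he]
  constructor
  · intro h
    refine ⟨fun h21 => h (Or.inl h21), fun h2o => h (Or.inr (Or.inr ⟨conn_trans h2o (conn_symm hyo),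
      conn_symm h1x⟩))⟩
  · rintro ⟨h21, h2o⟩ (h | ⟨h2x, _⟩ | ⟨h2y, _⟩)
    · exact h21 h
    · exact h21 (conn_trans h2x (conn_symm h1x))
    · exact h2o (conn_trans h2y hyo)

/-- **`v ∈ C₁` reads as `v ∈ C₁ ∨ v ↔ o`** on the support. -/
lemma reads_conn1 (he : ends e = s(x, y)) (hx : x ∈ cluster ends (Chord.oneConfig p) a₁)
    (hy : o ∈ cluster ends (Chord.oneConfig p) y) (hfr : e ∈ Chord.frac p) (v : V) :
    ReadsAsS p ends o a₁ a₂ e (connEvent ends a₁ v) (readL ends o a₁ v) := by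
  intro ω hω _
  have h1x := conn_a1_x hx hfr hω
  have hyo := conn_y_o hy hfr hω
  rw [update_true_eq ω]
  simp only [readL, Set.mem_union, mem_connEvent, OneEdge.conn_update_true_iff he]
  constructor
  · rintro (h | ⟨_, hyv⟩ | ⟨_, hxv⟩)
    · exact Or.inl h
    · exact Or.inr (conn_trans (conn_symm hyo) hyv)
    · exact Or.inl (conn_trans h1x hxv)
  · rintro (h | hov)
    · exact Or.inl h
    · exact Or.inr (Or.inl ⟨h1x, conn_trans hyo hov⟩)

/-- **`v ∈ C₂` reads as itself** on the support and on `Qo`. -/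
lemma reads_conn2 (he : ends e = s(x, y)) (hx : x ∈ cluster ends (Chord.oneConfig p) a₁)
    (hy : o ∈ cluster ends (Chord.oneConfig p) y) (hfr : e ∈ Chord.frac p) (v : V) :
    ReadsAsS p ends o a₁ a₂ e (connEvent ends a₂ v) (connEvent ends a₂ v) := by
  intro ω hω hQ
  have h1x := conn_a1_x hx hfr hω
  have hyo := conn_y_o hy hfr hω
  rw [mem_Qo_iff] at hQ
  rw [update_true_eq ω]
  simp only [mem_connEvent, OneEdge.conn_update_true_iff he]
  constructor
  · rintro (h | ⟨h2x, _⟩ | ⟨h2y, _⟩)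
    · exact h
    · exact absurd (conn_trans h2x (conn_symm h1x)) hQ.1
    · exact absurd (conn_trans h2y hyo) hQ.2
  · exact fun h => Or.inl h

omit [LinearOrder R] [IsStrictOrderedRing R] in
/-- Readings are closed under intersection. -/
lemma ReadsAsS.inter {S₁ S₁' S₂ S₂' : Set (Config E)} (h₁ : ReadsAsS p ends o a₁ a₂ e S₁ S₁')
    (h₂ : ReadsAsS p ends o a₁ a₂ e S₂ S₂') : ReadsAsS p ends o a₁ a₂ e (S₁ ∩ S₂) (S₁' ∩ S₂') := by
  intro ω hω hQ
  rw [Set.mem_inter_iff, Set.mem_inter_iff, h₁ ω hω hQ, h₂ ω hω hQ]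

omit [LinearOrder R] [IsStrictOrderedRing R] in
/-- Readings are closed under union. -/
lemma ReadsAsS.union {S₁ S₁' S₂ S₂' : Set (Config E)} (h₁ : ReadsAsS p ends o a₁ a₂ e S₁ S₁')
    (h₂ : ReadsAsS p ends o a₁ a₂ e S₂ S₂') : ReadsAsS p ends o a₁ a₂ e (S₁ ∪ S₂) (S₁' ∪ S₂') := by
  intro ω hω hQ
  rw [Set.mem_union, Set.mem_union, h₁ ω hω hQ, h₂ ω hω hQ]

omit [LinearOrder R] [IsStrictOrderedRing R] in
/-- Readings are closed under complement. -/
lemma ReadsAsS.compl {S S' : Set (Config E)} (h : ReadsAsS p ends o a₁ a₂ e S S') :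
    ReadsAsS p ends o a₁ a₂ e Sᶜ S'ᶜ := by
  intro ω hω hQ
  rw [Set.mem_compl_iff, Set.mem_compl_iff, h ω hω hQ]

omit [LinearOrder R] [IsStrictOrderedRing R] in
/-- `univ` reads as `univ`. -/
lemma ReadsAsS.univ : ReadsAsS p ends o a₁ a₂ e Set.univ Set.univ := fun _ _ _ => Iff.rfl

/-- **The coupling of the two children on a reading, on the support**: `P¹(Q ∩ S) = P⁰(Qo ∩ S′)`. -/
theorem prob_read (he : ends e = s(x, y)) (hx : x ∈ cluster ends (Chord.oneConfig p) a₁)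
    (hy : o ∈ cluster ends (Chord.oneConfig p) y) (hfr : e ∈ Chord.frac p) {S S' : Set (Config E)}
    (h : ReadsAsS p ends o a₁ a₂ e S S') :
    prob (Function.update p e 1) (avoidAll ends a₂ {a₁} ∩ S) =
      prob (Function.update p e 0) (Qo ends o a₁ a₂ ∩ S') := by
  apply prob_update_one_eq_prob_update_zero_of_iff_support p
  intro ω hω
  rw [Set.mem_inter_iff, Set.mem_inter_iff, Q_update_true_iff_support he hx hy hfr hω]
  exact ⟨fun ⟨h1, h2⟩ => ⟨h1, (h ω hω h1).1 h2⟩, fun ⟨h1, h2⟩ => ⟨h1, (h ω hω h1).2 h2⟩⟩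

end Reads

section Atoms

variable {V : Type*} {E : Type*} [Fintype E] [DecidableEq E] {R : Type*} [Field R] [LinearOrder R]
  [IsStrictOrderedRing R]

variable (p : E → R) {ends : E → Sym2 V} {o a₁ a₂ x y : V} (a₃ : V) {e : E}

/-- **`D¹ = P⁰(Qo ∩ {a₃ ∉ U after})`.** -/
theorem D_read (he : ends e = s(x, y)) (hx : x ∈ cluster ends (Chord.oneConfig p) a₁)
    (hy : o ∈ cluster ends (Chord.oneConfig p) y) (hfr : e ∈ Chord.frac p) :
    prob (Function.update p e 1) (PDEvent ends a₁ a₂ a₃) =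
      prob (Function.update p e 0) (Qo ends o a₁ a₂ ∩ nU ends o a₁ a₂ a₃) := by
  rw [PDEvent_eq_Q_inter]
  exact prob_read he hx hy hfr (((reads_conn1 he hx hy hfr a₃).union (reads_conn2 he hx hy hfr a₃)).compl)

/-- **`D_o¹`** read on the closed child. -/
theorem Do_read (he : ends e = s(x, y)) (hx : x ∈ cluster ends (Chord.oneConfig p) a₁)
    (hy : o ∈ cluster ends (Chord.oneConfig p) y) (hfr : e ∈ Chord.frac p) :
    Do (Function.update p e 1) ends o a₁ a₂ a₃ =
      prob (Function.update p e 0) (Qo ends o a₁ a₂ ∩ (nU ends o a₁ a₂ a₃ ∩ readL ends o a₁ o)) +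
        prob (Function.update p e 0) (Qo ends o a₁ a₂ ∩ (nU ends o a₁ a₂ a₃ ∩ connEvent ends a₂ o)) := by
  unfold Do
  rw [PDEvent_eq_Q_inter, Set.inter_assoc, Set.inter_assoc]
  rw [prob_read he hx hy hfr ((((reads_conn1 he hx hy hfr a₃).union (reads_conn2 he hx hy hfr a₃)).compl).inter (reads_conn1 he hx hy hfr o)),
    prob_read he hx hy hfr ((((reads_conn1 he hx hy hfr a₃).union (reads_conn2 he hx hy hfr a₃)).compl).inter (reads_conn2 he hx hy hfr o))]
  rfl

/-- **`E_Q[σ_bσ_o]` at the open child** read on the closed child. -/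
theorem EQbo_read (he : ends e = s(x, y)) (hx : x ∈ cluster ends (Chord.oneConfig p) a₁)
    (hy : o ∈ cluster ends (Chord.oneConfig p) y) (hfr : e ∈ Chord.frac p) (b : V) :
    EQbo (Function.update p e 1) ends o a₁ a₂ b =
      prob (Function.update p e 0) (Qo ends o a₁ a₂ ∩ (readL ends o a₁ o ∩ readL ends o a₁ b)) +
        prob (Function.update p e 0) (Qo ends o a₁ a₂ ∩ (connEvent ends a₂ o ∩ connEvent ends a₂ b)) -
        prob (Function.update p e 0) (Qo ends o a₁ a₂ ∩ (connEvent ends a₂ o ∩ readL ends o a₁ b)) -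
        prob (Function.update p e 0) (Qo ends o a₁ a₂ ∩ (readL ends o a₁ o ∩ connEvent ends a₂ b)) := by
  unfold EQbo
  rw [prob_read he hx hy hfr ((reads_conn1 he hx hy hfr o).inter (reads_conn1 he hx hy hfr b)),
    prob_read he hx hy hfr ((reads_conn2 he hx hy hfr o).inter (reads_conn2 he hx hy hfr b)),
    prob_read he hx hy hfr ((reads_conn2 he hx hy hfr o).inter (reads_conn1 he hx hy hfr b)),
    prob_read he hx hy hfr ((reads_conn1 he hx hy hfr o).inter (reads_conn2 he hx hy hfr b))]

/-- **`E_Q[σ_bσ₃]` at the open child** read on the closed child. -/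
theorem EQb3_read (he : ends e = s(x, y)) (hx : x ∈ cluster ends (Chord.oneConfig p) a₁)
    (hy : o ∈ cluster ends (Chord.oneConfig p) y) (hfr : e ∈ Chord.frac p) (b : V) :
    EQb3 (Function.update p e 1) ends a₁ a₂ a₃ b =
      prob (Function.update p e 0) (Qo ends o a₁ a₂ ∩ (readL ends o a₁ a₃ ∩ readL ends o a₁ b)) +
        prob (Function.update p e 0) (Qo ends o a₁ a₂ ∩ (connEvent ends a₂ a₃ ∩ connEvent ends a₂ b)) -
        prob (Function.update p e 0) (Qo ends o a₁ a₂ ∩ (connEvent ends a₂ a₃ ∩ readL ends o a₁ b)) -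
        prob (Function.update p e 0) (Qo ends o a₁ a₂ ∩ (readL ends o a₁ a₃ ∩ connEvent ends a₂ b)) := by
  unfold EQb3
  rw [TEvent_swap_eq_Q_inter ends a₁ a₂ a₃, TEvent_eq_Q_inter ends a₁ a₂ a₃, Set.inter_assoc, Set.inter_assoc,
    Set.inter_assoc, Set.inter_assoc]
  rw [prob_read he hx hy hfr ((reads_conn1 he hx hy hfr a₃).inter (reads_conn1 he hx hy hfr b)),
    prob_read he hx hy hfr ((reads_conn2 he hx hy hfr a₃).inter (reads_conn2 he hx hy hfr b)),
    prob_read he hx hy hfr ((reads_conn2 he hx hy hfr a₃).inter (reads_conn1 he hx hy hfr b)),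
    prob_read he hx hy hfr ((reads_conn1 he hx hy hfr a₃).inter (reads_conn2 he hx hy hfr b))]

/-- **`E_Q[σ₃]` at the open child** read on the closed child. -/
theorem EQ3_read (he : ends e = s(x, y)) (hx : x ∈ cluster ends (Chord.oneConfig p) a₁)
    (hy : o ∈ cluster ends (Chord.oneConfig p) y) (hfr : e ∈ Chord.frac p) :
    EQ3 (Function.update p e 1) ends a₁ a₂ a₃ =
      prob (Function.update p e 0) (Qo ends o a₁ a₂ ∩ readL ends o a₁ a₃) -
        prob (Function.update p e 0) (Qo ends o a₁ a₂ ∩ connEvent ends a₂ a₃) := by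
  unfold EQ3
  rw [TEvent_swap_eq_Q_inter ends a₁ a₂ a₃, TEvent_eq_Q_inter ends a₁ a₂ a₃, prob_read he hx hy hfr (reads_conn1 he hx hy hfr a₃),
    prob_read he hx hy hfr (reads_conn2 he hx hy hfr a₃)]

/-- **`E_Q[σ_o]` at the open child** read on the closed child. -/
theorem EQo_read (he : ends e = s(x, y)) (hx : x ∈ cluster ends (Chord.oneConfig p) a₁)
    (hy : o ∈ cluster ends (Chord.oneConfig p) y) (hfr : e ∈ Chord.frac p) :
    EQo (Function.update p e 1) ends o a₁ a₂ =
      prob (Function.update p e 0) (Qo ends o a₁ a₂ ∩ readL ends o a₁ o) -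
        prob (Function.update p e 0) (Qo ends o a₁ a₂ ∩ connEvent ends a₂ o) := by
  unfold EQo
  rw [prob_read he hx hy hfr (reads_conn1 he hx hy hfr o), prob_read he hx hy hfr (reads_conn2 he hx hy hfr o)]

/-- **`E_Q[σ₃ 1_{o ∈ U}]` at the open child** read on the closed child. -/
theorem EQ3o_read (he : ends e = s(x, y)) (hx : x ∈ cluster ends (Chord.oneConfig p) a₁)
    (hy : o ∈ cluster ends (Chord.oneConfig p) y) (hfr : e ∈ Chord.frac p) :
    EQ3o (Function.update p e 1) ends o a₁ a₂ a₃ =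
      prob (Function.update p e 0) (Qo ends o a₁ a₂ ∩ (readL ends o a₁ a₃ ∩ readL ends o a₁ o)) +
        prob (Function.update p e 0) (Qo ends o a₁ a₂ ∩ (readL ends o a₁ a₃ ∩ connEvent ends a₂ o)) -
        prob (Function.update p e 0) (Qo ends o a₁ a₂ ∩ (connEvent ends a₂ a₃ ∩ readL ends o a₁ o)) -
        prob (Function.update p e 0) (Qo ends o a₁ a₂ ∩ (connEvent ends a₂ a₃ ∩ connEvent ends a₂ o)) := by
  unfold EQ3o
  rw [TEvent_swap_eq_Q_inter ends a₁ a₂ a₃, TEvent_eq_Q_inter ends a₁ a₂ a₃, Set.inter_assoc, Set.inter_assoc,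
    Set.inter_assoc, Set.inter_assoc]
  rw [prob_read he hx hy hfr ((reads_conn1 he hx hy hfr a₃).inter (reads_conn1 he hx hy hfr o)),
    prob_read he hx hy hfr ((reads_conn1 he hx hy hfr a₃).inter (reads_conn2 he hx hy hfr o)),
    prob_read he hx hy hfr ((reads_conn2 he hx hy hfr a₃).inter (reads_conn1 he hx hy hfr o)),
    prob_read he hx hy hfr ((reads_conn2 he hx hy hfr a₃).inter (reads_conn2 he hx hy hfr o))]

/-- **`P(PD, b ∈ U)` at the open child** read on the closed child. -/
theorem PDb_read (he : ends e = s(x, y)) (hx : x ∈ cluster ends (Chord.oneConfig p) a₁)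
    (hy : o ∈ cluster ends (Chord.oneConfig p) y) (hfr : e ∈ Chord.frac p) (b : V) :
    PDb (Function.update p e 1) ends a₁ a₂ a₃ b =
      prob (Function.update p e 0) (Qo ends o a₁ a₂ ∩ (nU ends o a₁ a₂ a₃ ∩ readL ends o a₁ b)) +
        prob (Function.update p e 0) (Qo ends o a₁ a₂ ∩ (nU ends o a₁ a₂ a₃ ∩ connEvent ends a₂ b)) := by
  unfold PDb
  rw [PDEvent_eq_Q_inter, Set.inter_assoc, Set.inter_assoc]
  rw [prob_read he hx hy hfr ((((reads_conn1 he hx hy hfr a₃).union (reads_conn2 he hx hy hfr a₃)).compl).inter (reads_conn1 he hx hy hfr b)),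
    prob_read he hx hy hfr ((((reads_conn1 he hx hy hfr a₃).union (reads_conn2 he hx hy hfr a₃)).compl).inter (reads_conn2 he hx hy hfr b))]
  rfl

/-- **`E_Q[σ_bσ₃ 1_{o ∈ U}]` at the open child** read on the closed child. -/
theorem EQb3o_read (he : ends e = s(x, y)) (hx : x ∈ cluster ends (Chord.oneConfig p) a₁)
    (hy : o ∈ cluster ends (Chord.oneConfig p) y) (hfr : e ∈ Chord.frac p) (b : V) :
    EQb3o (Function.update p e 1) ends o a₁ a₂ a₃ b =
      prob (Function.update p e 0) (Qo ends o a₁ a₂ ∩ (readL ends o a₁ a₃ ∩ (readL ends o a₁ o ∩ readL ends o a₁ b))) +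
        prob (Function.update p e 0) (Qo ends o a₁ a₂ ∩ (readL ends o a₁ a₃ ∩ (connEvent ends a₂ o ∩ readL ends o a₁ b))) +
        prob (Function.update p e 0) (Qo ends o a₁ a₂ ∩ (connEvent ends a₂ a₃ ∩ (readL ends o a₁ o ∩ connEvent ends a₂ b))) +
        prob (Function.update p e 0) (Qo ends o a₁ a₂ ∩ (connEvent ends a₂ a₃ ∩ (connEvent ends a₂ o ∩ connEvent ends a₂ b))) -
        prob (Function.update p e 0) (Qo ends o a₁ a₂ ∩ (connEvent ends a₂ a₃ ∩ (readL ends o a₁ o ∩ readL ends o a₁ b))) -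
        prob (Function.update p e 0) (Qo ends o a₁ a₂ ∩ (connEvent ends a₂ a₃ ∩ (connEvent ends a₂ o ∩ readL ends o a₁ b))) -
        prob (Function.update p e 0) (Qo ends o a₁ a₂ ∩ (readL ends o a₁ a₃ ∩ (readL ends o a₁ o ∩ connEvent ends a₂ b))) -
        prob (Function.update p e 0) (Qo ends o a₁ a₂ ∩ (readL ends o a₁ a₃ ∩ (connEvent ends a₂ o ∩ connEvent ends a₂ b))) := by
  unfold EQb3o
  rw [TEvent_swap_eq_Q_inter ends a₁ a₂ a₃, TEvent_eq_Q_inter ends a₁ a₂ a₃, Set.inter_assoc, Set.inter_assoc,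
    Set.inter_assoc, Set.inter_assoc, Set.inter_assoc, Set.inter_assoc, Set.inter_assoc, Set.inter_assoc]
  rw [prob_read he hx hy hfr ((reads_conn1 he hx hy hfr a₃).inter ((reads_conn1 he hx hy hfr o).inter (reads_conn1 he hx hy hfr b))),
    prob_read he hx hy hfr ((reads_conn1 he hx hy hfr a₃).inter ((reads_conn2 he hx hy hfr o).inter (reads_conn1 he hx hy hfr b))),
    prob_read he hx hy hfr ((reads_conn2 he hx hy hfr a₃).inter ((reads_conn1 he hx hy hfr o).inter (reads_conn2 he hx hy hfr b))),
    prob_read he hx hy hfr ((reads_conn2 he hx hy hfr a₃).inter ((reads_conn2 he hx hy hfr o).inter (reads_conn2 he hx hy hfr b))),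
    prob_read he hx hy hfr ((reads_conn2 he hx hy hfr a₃).inter ((reads_conn1 he hx hy hfr o).inter (reads_conn1 he hx hy hfr b))),
    prob_read he hx hy hfr ((reads_conn2 he hx hy hfr a₃).inter ((reads_conn2 he hx hy hfr o).inter (reads_conn1 he hx hy hfr b))),
    prob_read he hx hy hfr ((reads_conn1 he hx hy hfr a₃).inter ((reads_conn1 he hx hy hfr o).inter (reads_conn2 he hx hy hfr b))),
    prob_read he hx hy hfr ((reads_conn1 he hx hy hfr a₃).inter ((reads_conn2 he hx hy hfr o).inter (reads_conn2 he hx hy hfr b)))]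

/-- **`P(PD, b ∈ U, o ∈ U)` at the open child** read on the closed child. -/
theorem PDbo_read (he : ends e = s(x, y)) (hx : x ∈ cluster ends (Chord.oneConfig p) a₁)
    (hy : o ∈ cluster ends (Chord.oneConfig p) y) (hfr : e ∈ Chord.frac p) (b : V) :
    PDbo (Function.update p e 1) ends o a₁ a₂ a₃ b =
      prob (Function.update p e 0) (Qo ends o a₁ a₂ ∩ (nU ends o a₁ a₂ a₃ ∩ (readL ends o a₁ o ∩ readL ends o a₁ b))) +
        prob (Function.update p e 0) (Qo ends o a₁ a₂ ∩ (nU ends o a₁ a₂ a₃ ∩ (connEvent ends a₂ o ∩ readL ends o a₁ b))) +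
        prob (Function.update p e 0) (Qo ends o a₁ a₂ ∩ (nU ends o a₁ a₂ a₃ ∩ (readL ends o a₁ o ∩ connEvent ends a₂ b))) +
        prob (Function.update p e 0) (Qo ends o a₁ a₂ ∩ (nU ends o a₁ a₂ a₃ ∩ (connEvent ends a₂ o ∩ connEvent ends a₂ b))) := by
  unfold PDbo
  rw [PDEvent_eq_Q_inter, Set.inter_assoc, Set.inter_assoc, Set.inter_assoc, Set.inter_assoc]
  rw [prob_read he hx hy hfr ((((reads_conn1 he hx hy hfr a₃).union (reads_conn2 he hx hy hfr a₃)).compl).inter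
      ((reads_conn1 he hx hy hfr o).inter (reads_conn1 he hx hy hfr b))),
    prob_read he hx hy hfr ((((reads_conn1 he hx hy hfr a₃).union (reads_conn2 he hx hy hfr a₃)).compl).inter
      ((reads_conn2 he hx hy hfr o).inter (reads_conn1 he hx hy hfr b))),
    prob_read he hx hy hfr ((((reads_conn1 he hx hy hfr a₃).union (reads_conn2 he hx hy hfr a₃)).compl).inter
      ((reads_conn1 he hx hy hfr o).inter (reads_conn2 he hx hy hfr b))),
    prob_read he hx hy hfr ((((reads_conn1 he hx hy hfr a₃).union (reads_conn2 he hx hy hfr a₃)).compl).inter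
      ((reads_conn2 he hx hy hfr o).inter (reads_conn2 he hx hy hfr b)))]
  rfl


/-- `a₁ ↔ b` after opening `e` reads as `a₁ ↔ b ∨ o ↔ b` on the support (no `Q` needed). -/
theorem prob_conn1_read (he : ends e = s(x, y)) (hx : x ∈ cluster ends (Chord.oneConfig p) a₁)
    (hy : o ∈ cluster ends (Chord.oneConfig p) y) (hfr : e ∈ Chord.frac p) (b : V) :
    prob (Function.update p e 1) (connEvent ends a₁ b) = prob (Function.update p e 0) (readL ends o a₁ b) := by
  apply prob_update_one_eq_prob_update_zero_of_iff_support p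
  intro ω hω
  have h1x := conn_a1_x hx hfr hω
  have hyo := conn_y_o hy hfr hω
  rw [update_true_eq ω]
  simp only [readL, Set.mem_union, mem_connEvent, OneEdge.conn_update_true_iff he]
  constructor
  · rintro (h | ⟨_, hyb⟩ | ⟨_, hxb⟩)
    · exact Or.inl h
    · exact Or.inr (conn_trans (conn_symm hyo) hyb)
    · exact Or.inl (conn_trans h1x hxb)
  · rintro (h | hob)
    · exact Or.inl h
    · exact Or.inr (Or.inl ⟨h1x, conn_trans hyo hob⟩)

/-- `a₂ ↔ b` after opening `e` reads as `a₂ ↔ b ∨ (a₂ ↔ o ∧ a₁ ↔ b) ∨ (a₂ ↔ a₁ ∧ o ↔ b)` on the support. -/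
theorem prob_conn2_read (he : ends e = s(x, y)) (hx : x ∈ cluster ends (Chord.oneConfig p) a₁)
    (hy : o ∈ cluster ends (Chord.oneConfig p) y) (hfr : e ∈ Chord.frac p) (b : V) :
    prob (Function.update p e 1) (connEvent ends a₂ b) =
      prob (Function.update p e 0) (connEvent ends a₂ b ∪ (connEvent ends a₂ o ∩ connEvent ends a₁ b) ∪
        (connEvent ends a₂ a₁ ∩ connEvent ends o b)) := by
  apply prob_update_one_eq_prob_update_zero_of_iff_support p
  intro ω hω
  have h1x := conn_a1_x hx hfr hω
  have hyo := conn_y_o hy hfr hω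
  rw [update_true_eq ω]
  simp only [Set.mem_union, Set.mem_inter_iff, mem_connEvent, OneEdge.conn_update_true_iff he]
  constructor
  · rintro (h | ⟨h2x, hyb⟩ | ⟨h2y, hxb⟩)
    · exact Or.inl (Or.inl h)
    · exact Or.inr ⟨conn_trans h2x (conn_symm h1x), conn_trans (conn_symm hyo) hyb⟩
    · exact Or.inl (Or.inr ⟨conn_trans h2y hyo, conn_trans h1x hxb⟩)
  · rintro ((h | ⟨h2o, h1b⟩) | ⟨h21, hob⟩)
    · exact Or.inl h
    · exact Or.inr (Or.inr ⟨conn_trans h2o (conn_symm hyo), conn_trans (conn_symm h1x) h1b⟩)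
    · exact Or.inr (Or.inl ⟨conn_trans h21 h1x, conn_trans hyo hob⟩)

/-- **The labelling gap at the open child** read on the closed child. -/
theorem gap_read (he : ends e = s(x, y)) (hx : x ∈ cluster ends (Chord.oneConfig p) a₁)
    (hy : o ∈ cluster ends (Chord.oneConfig p) y) (hfr : e ∈ Chord.frac p) (b : V) :
    gap (Function.update p e 1) ends a₁ a₂ b =
      prob (Function.update p e 0) (connEvent ends a₂ b ∪ (connEvent ends a₂ o ∩ connEvent ends a₁ b) ∪
        (connEvent ends a₂ a₁ ∩ connEvent ends o b)) -
        prob (Function.update p e 0) (readL ends o a₁ b) := by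
  unfold gap
  rw [prob_conn1_read (p := p) he hx hy hfr b, prob_conn2_read (p := p) he hx hy hfr b]

end Atoms

end OClassRead

end Mix

end Summit.Ventures.PercRepro2
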